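/-
Copyright (c) 2026 the pub-hodgecm-mathlib formalisation cell (harness21).  Prover seat hodgecm-mathlib-F0P2-p01 (g16): road «S3-ram» (LEAD F0P3a-plan (g13); owner F0P3a-p06 (g15)),
(T2) G-side organ (Cnt2′) (chair F0P3a-p07 (g14) rulings (3)(6)(8)), organ (z1-c) «TUBE LAYERS b ≥ 1», PART II(b=1) «COLLAR TOKENS» continued: (K4) the top level; 2026-09-02.
-/
import Literature.NumberTheory.Automorphic.UnitaryLatticeTreeTubeCollarTokens   -- ★ p848616 (this seat): (K0–K3) `collar_fixed_and_lev_of_axisLevel`, `collar_class_iff_of_axisLevel`, block bookkeeping `endoGL_sub_one_*`; brings ★ TubeCone ∕ TubeAxisVertex ∕ TubeCoordinate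
import HarnessLib

/-!
# The lattice graph of a hermitian space — COLLAR TOKENS (K4): when does a collar lattice reach the FULL level `D` of its axis vertex?
# (Kottwitz 1986 §3; Rogawski 1990 §4.9; Bruhat–Tits 1972 §10)

Topic `NumberTheory/Automorphic`; namespace `Literature.NumberTheory.Automorphic.UnitaryLatticeTree`.  THEOREMS ONLY (no definition, no instance, no notation, no named fact,
no `sorry`); kernel lane `--supports stmt-HodgeConjecture-24833`; datum-free (`K` with `Valued K ℤᵐ⁰`, `[IsPrincipalIdealRing 𝒪[K]]`).  Cell `pub/hodgecm-mathlib` (D-0151),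
crux H413; road «S3-ram» (Literature seeding, count-neutral); (T2) G-side organ (Cnt2′) (chair F0P3a-p07 (g14)), organ (z1-c) «TUBE LAYERS b ≥ 1», PART II(b=1) «COLLAR
TOKENS» (★ `UnitaryLatticeTreeTubeCollarTokens` p848616: K0 fixed, K1 `LEV(ϖ^{D−2})`, K2 `LEV(ϖ^{D−1}) ⟺ |val| < 1`, K3 class `⟺ −val`), answering F0P2-p02 (g14) 03:34:36Z
(route B «TYPE-(2) JUNCTION», organ «J2-POOL» of F0P3a-p02 (g18)): «do the "0"-collar grandchildren of a region vertex have dep `= d₀ − 1` or more?».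
BLOCK CURRENCY as in ★ p848616: `H = !![H₂ 0 0, 0, H₂ 0 1; 0, h, 0; H₂ 1 0, 0, H₂ 1 1]`, `Γ = ι(γ₂, u) = endoGL (γ₂, u)` — here moreover UNITARY for `H` (`hΓU`) — `M` self-dual
with tube coordinate `1` (a COLLAR lattice), generator `x₀`, axis vertex `A(M) = (M ∩ W) ⊔ ϖ·M ⊔ 𝒪e₁` with `(Γ − 1)A(M) ⊆ ϖ^D A(M)`, `D ≥ 2`, `x = ϖx₀`,
`val = ϖ^{−D}⟨x, (Γ − 1)x⟩`, glued vector `z = ϖ·(x₀ − x₀(1)e₁) ∈ A(M) ∩ W` (`|⟨z,z⟩| = 1`, ★ (c3-ii)).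

THE MATHEMATICS.  By the LEV law on the cone (★ (c3-iv′) `forall_mulVec_mem_scaleLattice_iff_of_cone`, `T = Γ − 1`, `c = ϖ^D`), `LEV_M(ϖ^D)` is the conjunction of
(a) `|u₀₀ − 1| ≤ |ϖ|^D` (the axis level at `e₁` — automatic), (b) the `W`-clause `(Γ − 1)(M ∩ W) ⊆ ϖ^D·M`, (c) the generator clause `(Γ − u₀₀)z ∈ ϖ^{D+1}·A(M)` (ONE level
deeper than the axis guarantees), (d) the value clause `|⟨z, (Γ − u₀₀)z⟩| ≤ |ϖ|^{D+2}`, which by ★ (c3-v) (`⟨x,(Γ−1)x⟩ − ⟨z,(Γ−u₀₀)z⟩ = (u₀₀−1)(⟨z,z⟩ + hN(ϖx₀(1)))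
∈ ϖ^{D+2}𝒪`) reads `|val| ≤ |ϖ|²`.  The point (§1): for UNITARY `Γ`, (b) FOLLOWS from (c): `M ∩ W = {w ∈ A(M) ∩ W : |⟨z, w⟩| ≤ |ϖ|}` (★ (c3-ii)) and for such `w`,
`⟨z, (Γ−1)w⟩ = −⟨(Γ−1)z, Γw⟩ = −⟨(Γ−u₀₀)z, Γw⟩ − σ(u₀₀−1)·⟨z, Γw⟩ ∈ ϖ^{D+1}𝒪`.  Hence **(K4) `LEV_M(ϖ^D) ⟺ (Γ − u₀₀)z ∈ ϖ^{D+1}A(M) ∧ |val| ≤ |ϖ|²`**.  Two regimes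
(§2): if the axis vertex has `W`-level `≥ D+1` but `|u₀₀ − 1| = |ϖ|^D` («u strictly shallower»), (c) would force `(u₀₀−1)z ∈ ϖ^{D+1}A(M)`, i.e. `ϖ⁻¹z ∈ A(M) ⊆ A(M)^#`,
contradicting `|⟨z,z⟩| = 1` — **(K4′) no collar lattice reaches level `D`** (the collar of a region vertex holds no region member; its «0»-part is exactly the E-token);
if `|u₀₀ − 1| ≤ |ϖ|^{D+1}` («u strictly deeper»), **(K4″) `LEV_M(ϖ^D) ⟺ (Γ − 1)z ∈ ϖ^{D+1}A(M) ∧ |val| ≤ |ϖ|²`** (residually: `z̄ ∈ ker(ϖ^{−D}(γ₂ − 1) mod ϖ)`, two value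
digits vanish).

* §1 **`collar_levTop_iff_of_axisLevel`** (K4).
* §2 **`collar_not_levTop_of_unit_shallower`** (K4′), **`collar_levTop_iff_of_unit_deeper`** (K4″).

HONEST LABEL: HC_CM is proved only modulo the 2 remaining named inputs (hLiu418 24832, h413 24833) until rung 0 closes; nothing printed is asserted here (elementary lattice
algebra over a discretely valued field); «S3-ram» has no books consequence.

## References
* [Kottwitz1986] R. E. Kottwitz, *Base change for unit elements of Hecke algebras*, Compositio Math. 60 (1986), §3 (fixed lattices of an elliptic element; depth bookkeeping).
* [Rogawski1990] J. D. Rogawski, *Automorphic Representations of Unitary Groups in Three Variables*, Ann. of Math. Stud. 123 (1990), §4.8 Case (a) p. 53 (the pattern `ι`), §4.9 p. 55.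
* [BruhatTits1972] F. Bruhat, J. Tits, *Groupes réductifs sur un corps local I*, Publ. Math. IHÉS 41 (1972), §10 (lattice models of the building).
-/

set_option autoImplicit false

noncomputable section

open scoped Valued WithZero Matrix MatrixGroups

namespace Literature.NumberTheory.Automorphic.UnitaryLatticeTree

open Literature.NumberTheory.Automorphic Literature.NumberTheory.Automorphic.HermitianLattice Literature.NumberTheory.Rogawski1990

variable {K : Type*} [Field K] [Valued K ℤᵐ⁰]

/-! ## §1 (K4) THE TOP LEVEL OF A COLLAR LATTICE -/

/-- **COLLAR TOP LEVEL (K4).**  In the situation of `collar_fixed_and_lev_of_axisLevel` (block form, `Γ = ι(γ₂, u)`, `M` self-dual with tube coordinate `1` and generator `x₀`,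
axis vertex `A(M)` with `(Γ − 1)·A(M) ⊆ ϖ^D·A(M)`, `D ≥ 2`, `x = ϖx₀`, `val = ϖ^{−D}⟨x, (Γ − 1)x⟩`, glued vector `z = ϖ·(x₀ − x₀(1)e₁) ∈ A(M) ∩ W`) and with `Γ` UNITARY for the
block form: **`LEV_M(ϖ^D) ⟺ (Γ − u₀₀·1)·z ∈ ϖ^{D+1}·A(M) ∧ |val| ≤ |ϖ|²`** — the collar lattice has the FULL level of its axis vertex iff the glued vector is moved one level
deeper than the axis guarantees (residually: `z̄` is an eigenvector of `ϖ^{−D}(γ₂ − 1)` for the eigenvalue `ϖ^{−D}(u₀₀ − 1)`) and two digits of the value vanish.  By the LEV law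
on the cone (★ (c3-iv′) `forall_mulVec_mem_scaleLattice_iff_of_cone` at `c = ϖ^D`): the scalar clause is the axis level at `e₁`, the generator clause is the first conjunct, the
value clause `|⟨z, (Γ − u₀₀)z⟩| ≤ |ϖ|^{D+2}` is `|val| ≤ |ϖ|²` by ★ (c3-v) (`⟨x,(Γ−1)x⟩ − ⟨z,(Γ−u₀₀)z⟩ = (u₀₀−1)(⟨z,z⟩ + hN(ϖx₀(1))) ∈ ϖ^{D+2}𝒪`), and the `W`-clause
`(Γ − 1)(M ∩ W) ⊆ ϖ^D·M` FOLLOWS from the generator clause by unitarity: for `w ∈ M ∩ W = {w ∈ A(M) ∩ W : |⟨z,w⟩| ≤ |ϖ|}` one has `⟨z, (Γ−1)w⟩ = −⟨(Γ−1)z, Γw⟩ =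
−⟨(Γ−u₀₀)z, Γw⟩ − σ(u₀₀−1)·⟨z, Γw⟩ ∈ ϖ^{D+1}𝒪`.  USE (route B, region census): a collar grandchild `w` of a region vertex `v` (`LEV[v](ϖ^{d₀})`) is itself a region
member iff K4 holds; otherwise its «0»∕«1±» label is the E ∕ P ∕ M token of ★ `collar_fixed_and_lev_of_axisLevel` ∕ `collar_class_iff_of_axisLevel`.
[cite: Kottwitz1986, §3] [cite: Rogawski1990, §4.9 p. 55] [cite: BruhatTits1972, §10] -/
theorem collar_levTop_iff_of_axisLevel [IsPrincipalIdealRing 𝒪[K]] (σ : K →+* K) (hσ : ∀ a, σ (σ a) = a) (hvσ : ∀ a, Valued.v (σ a) = Valued.v a)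
    {ϖ : K} (hϖ : Valued.v ϖ = WithZero.exp (-1 : ℤ))
    {H₂ : Matrix (Fin 2) (Fin 2) K} (hH₂ : IsUnit H₂.det) (hH₂σ : (H₂.map σ)ᵀ = H₂) {h : K} (hh : Valued.v h = 1) (hhσ : σ h = h)
    {M : Submodule 𝒪[K] (Fin 3 → K)} (hM : IsSelfDualLattice σ ϖ (!![H₂ 0 0, 0, H₂ 0 1; 0, h, 0; H₂ 1 0, 0, H₂ 1 1] : Matrix (Fin 3) (Fin 3) K) M)
    (hb : ∀ a : K, (Pi.single 1 a : Fin 3 → K) ∈ M ↔ Valued.v a ≤ Valued.v ϖ ^ 1)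
    {x₀ : Fin 3 → K} (hx₀ : x₀ ∈ M) (hx₀1 : Valued.v (x₀ 1) * Valued.v ϖ ^ 1 = 1)
    (γ₂ : GL (Fin 2) K) (u : GL (Fin 1) K) (hΓU : endoGL (γ₂, u) ∈ unitaryGroupOfForm σ (!![H₂ 0 0, 0, H₂ 0 1; 0, h, 0; H₂ 1 0, 0, H₂ 1 1] : Matrix (Fin 3) (Fin 3) K)) {D : ℕ} (hD : 2 ≤ D)
    (hAlev : ∀ a ∈ M ⊓ LinearMap.ker ((LinearMap.proj (1 : Fin 3) : (Fin 3 → K) →ₗ[K] K).restrictScalars 𝒪[K]) ⊔ scaleLattice (ϖ ^ 1) M ⊔ Submodule.span 𝒪[K] {(Pi.single 1 1 : Fin 3 → K)}, (((endoGL (γ₂, u) : GL (Fin 3) K) : Matrix (Fin 3) (Fin 3) K) - 1) *ᵥ a ∈ scaleLattice (ϖ ^ D) (M ⊓ LinearMap.ker ((LinearMap.proj (1 : Fin 3) : (Fin 3 → K) →ₗ[K] K).restrictScalars 𝒪[K]) ⊔ scaleLattice (ϖ ^ 1) M ⊔ Submodule.span 𝒪[K] {(Pi.single 1 1 : Fin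 3 → K)})) :
    (∀ y ∈ M, (((endoGL (γ₂, u) : GL (Fin 3) K) : Matrix (Fin 3) (Fin 3) K) - 1) *ᵥ y ∈ scaleLattice (ϖ ^ D) M) ↔
      ((((endoGL (γ₂, u) : GL (Fin 3) K) : Matrix (Fin 3) (Fin 3) K) - (u : Matrix (Fin 1) (Fin 1) K) 0 0 • (1 : Matrix (Fin 3) (Fin 3) K)) *ᵥ ((ϖ ^ 1) • (x₀ - Pi.single 1 (x₀ 1))) ∈ scaleLattice (ϖ ^ (D + 1)) (M ⊓ LinearMap.ker ((LinearMap.proj (1 : Fin 3) : (Fin 3 → K) →ₗ[K] K).restrictScalars 𝒪[K]) ⊔ scaleLattice (ϖ ^ 1) M ⊔ Submodule.span 𝒪[K] {(Pi.single 1 1 : Fin 3 → K)}) ∧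
        Valued.v ((ϖ ^ D)⁻¹ * pairing σ (!![H₂ 0 0, 0, H₂ 0 1; 0, h, 0; H₂ 1 0, 0, H₂ 1 1] : Matrix (Fin 3) (Fin 3) K) (ϖ • x₀) ((((endoGL (γ₂, u) : GL (Fin 3) K) : Matrix (Fin 3) (Fin 3) K) - 1) *ᵥ (ϖ • x₀))) ≤ Valued.v ϖ ^ 2) := by
  -- notation-free abbreviations (as in §2)
  have hY11 := endoGL_sub_one_apply_one_one γ₂ u
  have hYu := endoGL_sub_one_sub_smul_one γ₂ u
  have hYcol := endoGL_sub_one_col γ₂ u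
  have hYrow := endoGL_sub_one_row γ₂ u
  have hϖ0' : Valued.v ϖ ≠ 0 := by rw [hϖ]; exact WithZero.exp_ne_zero
  have hϖ0 : ϖ ≠ 0 := fun h0 => by rw [h0, map_zero] at hϖ0'; exact hϖ0' rfl
  have hϖ1 : Valued.v ϖ ≤ 1 := by rw [hϖ, ← WithZero.exp_zero, WithZero.exp_le_exp]; omega
  have hϖD0 : ϖ ^ D ≠ 0 := pow_ne_zero _ hϖ0
  have hϖD0' : Valued.v ϖ ^ D ≠ 0 := pow_ne_zero _ hϖ0'
  have hϖD10 : ϖ ^ (D + 1) ≠ 0 := pow_ne_zero _ hϖ0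
  have hb1 : 1 ≤ 1 := le_refl 1
  -- axis vertex data
  obtain ⟨he₁A, hA1, hASD⟩ := isSelfDualLattice_axisVertex_of_tubeCoordinate σ hσ hvσ hϖ hH₂ hH₂σ hh hhσ hM hb
  have hAint := le_dualLatt_of_isVertexLattice hvσ hASD
  obtain ⟨hzA, -, hziso, hWiff⟩ := cone_anatomy_of_tubeCoordinate σ hvσ hϖ hH₂ hh hM hb1 hb hx₀ hx₀1
  -- `|u − 1| ≤ |ϖ|^D` (pair the axis level with `e₁`)
  have hδ : Valued.v ((u : Matrix (Fin 1) (Fin 1) K) 0 0 - 1) ≤ Valued.v ϖ ^ D := by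
    have h1 := hAlev _ he₁A
    rw [mulVec_single_one_of_block hYcol, hY11, mul_one, mem_scaleLattice_iff hϖD0] at h1
    have e : (ϖ ^ D)⁻¹ • (Pi.single 1 ((u : Matrix (Fin 1) (Fin 1) K) 0 0 - 1) : Fin 3 → K) = Pi.single 1 ((ϖ ^ D)⁻¹ * ((u : Matrix (Fin 1) (Fin 1) K) 0 0 - 1)) := by
      ext k; rcases eq_or_ne k 1 with rfl | hk <;> simp [*]
    rw [e] at h1
    have h2 := hA1 _ h1
    rw [Pi.single_eq_same, map_mul, map_inv₀, map_pow, inv_mul_le_iff₀ (zero_lt_iff.2 hϖD0'), mul_one] at h2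
    exact h2
  -- pairings inside `A(M)` are integral; `ϖ^n•a` against `A(M)`
  have hAA : ∀ a ∈ M ⊓ LinearMap.ker ((LinearMap.proj (1 : Fin 3) : (Fin 3 → K) →ₗ[K] K).restrictScalars 𝒪[K]) ⊔ scaleLattice (ϖ ^ 1) M ⊔ Submodule.span 𝒪[K] {(Pi.single 1 1 : Fin 3 → K)}, ∀ a' ∈ M ⊓ LinearMap.ker ((LinearMap.proj (1 : Fin 3) : (Fin 3 → K) →ₗ[K] K).restrictScalars 𝒪[K]) ⊔ scaleLattice (ϖ ^ 1) M ⊔ Submodule.span 𝒪[K] {(Pi.single 1 1 : Fin 3 → K)}, Valued.v (pairing σ (!![H₂ 0 0, 0, H₂ 0 1; 0, h, 0; H₂ 1 0, 0, H₂ 1 1] : Matrix (Fin 3) (Fin 3) K) a a') ≤ 1 := fun a ha a' ha' => (mem_dualLatt σ _ _ a').1 (hAint ha') _ ha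
  have hcone := forall_mulVec_mem_scaleLattice_iff_of_cone σ hvσ hϖ hH₂ hh hM hb1 hb hx₀ hx₀1 hYcol hYrow hϖD0
  rw [hcone]
  -- clause (a): the scalar
  have ha : Valued.v ((((endoGL (γ₂, u) : GL (Fin 3) K) : Matrix (Fin 3) (Fin 3) K) - 1) 1 1) ≤ Valued.v (ϖ ^ D) := by rw [hY11, map_pow]; exact hδ
  -- clause (c) is the generator clause
  have hgen_iff : ((((endoGL (γ₂, u) : GL (Fin 3) K) : Matrix (Fin 3) (Fin 3) K) - 1) - (((endoGL (γ₂, u) : GL (Fin 3) K) : Matrix (Fin 3) (Fin 3) K) - 1) 1 1 • (1 : Matrix (Fin 3) (Fin 3) K)) *ᵥ ((ϖ ^ 1) • (x₀ - Pi.single 1 (x₀ 1))) ∈ scaleLattice (ϖ ^ 1 * ϖ ^ D) (M ⊓ LinearMap.ker ((LinearMap.proj (1 : Fin 3) : (Fin 3 → K) →ₗ[K] K).restrictScalars 𝒪[K]) ⊔ scaleLattice (ϖ ^ 1) M ⊔ Submodule.span 𝒪[K] {(Pi.single 1 1 : Fin 3 → K)}) ↔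
      (((endoGL (γ₂, u) : GL (Fin 3) K) : Matrix (Fin 3) (Fin 3) K) - (u : Matrix (Fin 1) (Fin 1) K) 0 0 • (1 : Matrix (Fin 3) (Fin 3) K)) *ᵥ ((ϖ ^ 1) • (x₀ - Pi.single 1 (x₀ 1))) ∈ scaleLattice (ϖ ^ (D + 1)) (M ⊓ LinearMap.ker ((LinearMap.proj (1 : Fin 3) : (Fin 3 → K) →ₗ[K] K).restrictScalars 𝒪[K]) ⊔ scaleLattice (ϖ ^ 1) M ⊔ Submodule.span 𝒪[K] {(Pi.single 1 1 : Fin 3 → K)}) := by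
    rw [hYu, ← pow_add, add_comm]
  -- clause (d) is the value clause, via ★ (c3-v)
  have hx : (ϖ • x₀ : Fin 3 → K) = ((ϖ ^ 1) • (x₀ - Pi.single 1 (x₀ 1))) + (ϖ * x₀ 1) • (Pi.single 1 1 : Fin 3 → K) := by
    ext k; rcases eq_or_ne k 1 with rfl | hk
    · simp
    · simp [hk]
  have hz1 : (((ϖ ^ 1) • (x₀ - Pi.single 1 (x₀ 1))) : Fin 3 → K) 1 = 0 := by simp
  have hcv := pairing_add_single_endoGL_sub_one σ H₂ h hz1 (ϖ * x₀ 1) γ₂ u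
  have hBsmall : Valued.v (((u : Matrix (Fin 1) (Fin 1) K) 0 0 - 1) * (pairing σ (!![H₂ 0 0, 0, H₂ 0 1; 0, h, 0; H₂ 1 0, 0, H₂ 1 1] : Matrix (Fin 3) (Fin 3) K) ((ϖ ^ 1) • (x₀ - Pi.single 1 (x₀ 1))) ((ϖ ^ 1) • (x₀ - Pi.single 1 (x₀ 1))) + σ (ϖ * x₀ 1) * h * (ϖ * x₀ 1))) ≤ Valued.v ϖ ^ D * Valued.v ϖ ^ 2 := by
    rw [map_mul]
    refine mul_le_mul' hδ ?_
    have e : σ (ϖ * x₀ 1) * h * (ϖ * x₀ 1) = h * σ (ϖ ^ 1 * x₀ 1) * (ϖ ^ 1 * x₀ 1) := by rw [pow_one]; ring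
    have hz2 := hziso
    rw [mul_one] at hz2
    rw [e]; exact hz2
  have hval_iff : Valued.v (pairing σ (!![H₂ 0 0, 0, H₂ 0 1; 0, h, 0; H₂ 1 0, 0, H₂ 1 1] : Matrix (Fin 3) (Fin 3) K) ((ϖ ^ 1) • (x₀ - Pi.single 1 (x₀ 1))) (((((endoGL (γ₂, u) : GL (Fin 3) K) : Matrix (Fin 3) (Fin 3) K) - 1) - (((endoGL (γ₂, u) : GL (Fin 3) K) : Matrix (Fin 3) (Fin 3) K) - 1) 1 1 • (1 : Matrix (Fin 3) (Fin 3) K)) *ᵥ ((ϖ ^ 1) • (x₀ - Pi.single 1 (x₀ 1))))) ≤ Valued.v ϖ ^ (2 * 1) * Valued.v (ϖ ^ D) ↔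
      Valued.v ((ϖ ^ D)⁻¹ * pairing σ (!![H₂ 0 0, 0, H₂ 0 1; 0, h, 0; H₂ 1 0, 0, H₂ 1 1] : Matrix (Fin 3) (Fin 3) K) (ϖ • x₀) ((((endoGL (γ₂, u) : GL (Fin 3) K) : Matrix (Fin 3) (Fin 3) K) - 1) *ᵥ (ϖ • x₀))) ≤ Valued.v ϖ ^ 2 := by
    rw [hYu, mul_one, map_pow, mul_comm (Valued.v ϖ ^ 2), map_mul, map_inv₀, map_pow, inv_mul_le_iff₀ (zero_lt_iff.2 hϖD0'), hx, hcv]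
    constructor
    · intro hd
      exact (Valuation.map_add _ _ _).trans (max_le hd hBsmall)
    · intro hsum
      have e : pairing σ (!![H₂ 0 0, 0, H₂ 0 1; 0, h, 0; H₂ 1 0, 0, H₂ 1 1] : Matrix (Fin 3) (Fin 3) K) ((ϖ ^ 1) • (x₀ - Pi.single 1 (x₀ 1))) ((((endoGL (γ₂, u) : GL (Fin 3) K) : Matrix (Fin 3) (Fin 3) K) - (u : Matrix (Fin 1) (Fin 1) K) 0 0 • (1 : Matrix (Fin 3) (Fin 3) K)) *ᵥ ((ϖ ^ 1) • (x₀ - Pi.single 1 (x₀ 1)))) =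
          (pairing σ (!![H₂ 0 0, 0, H₂ 0 1; 0, h, 0; H₂ 1 0, 0, H₂ 1 1] : Matrix (Fin 3) (Fin 3) K) ((ϖ ^ 1) • (x₀ - Pi.single 1 (x₀ 1))) ((((endoGL (γ₂, u) : GL (Fin 3) K) : Matrix (Fin 3) (Fin 3) K) - (u : Matrix (Fin 1) (Fin 1) K) 0 0 • (1 : Matrix (Fin 3) (Fin 3) K)) *ᵥ ((ϖ ^ 1) • (x₀ - Pi.single 1 (x₀ 1)))) + ((u : Matrix (Fin 1) (Fin 1) K) 0 0 - 1) * (pairing σ (!![H₂ 0 0, 0, H₂ 0 1; 0, h, 0; H₂ 1 0, 0, H₂ 1 1] : Matrix (Fin 3) (Fin 3) K) ((ϖ ^ 1) • (x₀ - Pi.single 1 (x₀ 1))) ((ϖ ^ 1) • (x₀ - Pi.single 1 (x₀ 1))) + σ (ϖ * x₀ 1) * h * (ϖ * x₀ 1))) -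
            ((u : Matrix (Fin 1) (Fin 1) K) 0 0 - 1) * (pairing σ (!![H₂ 0 0, 0, H₂ 0 1; 0, h, 0; H₂ 1 0, 0, H₂ 1 1] : Matrix (Fin 3) (Fin 3) K) ((ϖ ^ 1) • (x₀ - Pi.single 1 (x₀ 1))) ((ϖ ^ 1) • (x₀ - Pi.single 1 (x₀ 1))) + σ (ϖ * x₀ 1) * h * (ϖ * x₀ 1)) := by ring
      rw [e]
      exact (Valuation.map_sub _ _ _).trans (max_le hsum hBsmall)
  -- clause (b), the `W`-clause, follows from the generator clause by unitarity
  have hWofgen : (((endoGL (γ₂, u) : GL (Fin 3) K) : Matrix (Fin 3) (Fin 3) K) - (u : Matrix (Fin 1) (Fin 1) K) 0 0 • (1 : Matrix (Fin 3) (Fin 3) K)) *ᵥ ((ϖ ^ 1) • (x₀ - Pi.single 1 (x₀ 1))) ∈ scaleLattice (ϖ ^ (D + 1)) (M ⊓ LinearMap.ker ((LinearMap.proj (1 : Fin 3) : (Fin 3 → K) →ₗ[K] K).restrictScalars 𝒪[K]) ⊔ scaleLattice (ϖ ^ 1) M ⊔ Submodule.span 𝒪[K] {(Pi.single 1 1 :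 Fin 3 → K)}) →
      ∀ w ∈ M, w 1 = 0 → (((endoGL (γ₂, u) : GL (Fin 3) K) : Matrix (Fin 3) (Fin 3) K) - 1) *ᵥ w ∈ scaleLattice (ϖ ^ D) M := by
    intro hg w hw hw1
    have hwA : w ∈ M ⊓ LinearMap.ker ((LinearMap.proj (1 : Fin 3) : (Fin 3 → K) →ₗ[K] K).restrictScalars 𝒪[K]) ⊔ scaleLattice (ϖ ^ 1) M ⊔ Submodule.span 𝒪[K] {(Pi.single 1 1 : Fin 3 → K)} := Submodule.mem_sup_left (Submodule.mem_sup_left ⟨hw, (mem_kerProj_one_iff w).2 hw1⟩)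
    have hYwA := hAlev w hwA
    rw [mem_scaleLattice_iff hϖD0] at hYwA ⊢
    -- `Y w ∈ W`
    have hYw1 : ((((endoGL (γ₂, u) : GL (Fin 3) K) : Matrix (Fin 3) (Fin 3) K) - 1) *ᵥ w) 1 = 0 := by
      simp only [Matrix.mulVec, dotProduct, Fin.sum_univ_three, hYrow 0 (by decide), hYrow 2 (by decide), hw1, mul_zero, zero_mul, add_zero]
    refine ((hWiff ((ϖ ^ D)⁻¹ • ((((endoGL (γ₂, u) : GL (Fin 3) K) : Matrix (Fin 3) (Fin 3) K) - 1) *ᵥ w))).2 ⟨hYwA, by rw [Pi.smul_apply, hYw1, smul_zero], ?_⟩).1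
    -- `|⟨z, ϖ^{-D}·(Γ−1)w⟩| ≤ |ϖ|`, i.e. `|⟨z, (Γ−1)w⟩| ≤ |ϖ|^{D+1}`
    rw [LinearMap.map_smul, smul_eq_mul, map_mul, map_inv₀, map_pow, inv_mul_le_iff₀ (zero_lt_iff.2 hϖD0'), ← pow_add]
    -- `Γ w ∈ A(M)`
    have hΓw : ((endoGL (γ₂, u) : GL (Fin 3) K) : Matrix (Fin 3) (Fin 3) K) *ᵥ w = w + (((endoGL (γ₂, u) : GL (Fin 3) K) : Matrix (Fin 3) (Fin 3) K) - 1) *ᵥ w := by rw [Matrix.sub_mulVec, Matrix.one_mulVec, add_sub_cancel]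
    have hΓwA : ((endoGL (γ₂, u) : GL (Fin 3) K) : Matrix (Fin 3) (Fin 3) K) *ᵥ w ∈ M ⊓ LinearMap.ker ((LinearMap.proj (1 : Fin 3) : (Fin 3 → K) →ₗ[K] K).restrictScalars 𝒪[K]) ⊔ scaleLattice (ϖ ^ 1) M ⊔ Submodule.span 𝒪[K] {(Pi.single 1 1 : Fin 3 → K)} := by
      rw [hΓw]
      refine Submodule.add_mem _ hwA ?_
      have := hAlev w hwA
      exact scaleLattice_le_self_of_v_le_one (by rw [map_pow]; exact pow_le_one₀ zero_le hϖ1) _ this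
    -- `⟨z, (Γ−1)w⟩ = −⟨(Γ−1)z, Γw⟩` (unitarity)
    have hU := pairing_mulVec_mulVec_of_mem_unitary hΓU ((ϖ ^ 1) • (x₀ - Pi.single 1 (x₀ 1))) w
    have e1 : pairing σ (!![H₂ 0 0, 0, H₂ 0 1; 0, h, 0; H₂ 1 0, 0, H₂ 1 1] : Matrix (Fin 3) (Fin 3) K) ((ϖ ^ 1) • (x₀ - Pi.single 1 (x₀ 1))) ((((endoGL (γ₂, u) : GL (Fin 3) K) : Matrix (Fin 3) (Fin 3) K) - 1) *ᵥ w) = -(pairing σ (!![H₂ 0 0, 0, H₂ 0 1; 0, h, 0; H₂ 1 0, 0, H₂ 1 1] : Matrix (Fin 3) (Fin 3) K) ((((endoGL (γ₂, u) : GL (Fin 3) K) : Matrix (Fin 3) (Fin 3) K) - 1) *ᵥ ((ϖ ^ 1) • (x₀ - Pi.single 1 (x₀ 1)))) (((endoGL (γ₂, u) : GL (Fin 3) K) : Matrix (Fin 3) (Fin 3) K) *ᵥ w)) := by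
      rw [Matrix.sub_mulVec, Matrix.one_mulVec, LinearMap.map_sub, Matrix.sub_mulVec, Matrix.one_mulVec, LinearMap.map_sub, LinearMap.sub_apply, hU]
      ring
    -- `(Γ−1)z = (Γ−u)z + (u−1)z`
    have e2 : (((endoGL (γ₂, u) : GL (Fin 3) K) : Matrix (Fin 3) (Fin 3) K) - 1) *ᵥ ((ϖ ^ 1) • (x₀ - Pi.single 1 (x₀ 1))) = (((endoGL (γ₂, u) : GL (Fin 3) K) : Matrix (Fin 3) (Fin 3) K) - (u : Matrix (Fin 1) (Fin 1) K) 0 0 • (1 : Matrix (Fin 3) (Fin 3) K)) *ᵥ ((ϖ ^ 1) • (x₀ - Pi.single 1 (x₀ 1))) + ((u : Matrix (Fin 1) (Fin 1) K) 0 0 - 1) • ((ϖ ^ 1) • (x₀ - Pi.single 1 (x₀ 1))) := by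
      rw [← hYu, sub_smul_one_mulVec, hY11, sub_add_cancel]
    rw [e1, Valuation.map_neg, e2, LinearMap.map_add, LinearMap.add_apply, LinearMap.map_smulₛₗ, LinearMap.smul_apply, smul_eq_mul]
    refine (Valuation.map_add _ _ _).trans (max_le ?_ ?_)
    · -- `|⟨(Γ−u)z, Γw⟩| ≤ |ϖ|^{D+1}`
      rw [mem_scaleLattice_iff hϖD10] at hg
      have e3 : (((endoGL (γ₂, u) : GL (Fin 3) K) : Matrix (Fin 3) (Fin 3) K) - (u : Matrix (Fin 1) (Fin 1) K) 0 0 • (1 : Matrix (Fin 3) (Fin 3) K)) *ᵥ ((ϖ ^ 1) • (x₀ - Pi.single 1 (x₀ 1))) = (ϖ ^ (D + 1)) • ((ϖ ^ (D + 1))⁻¹ • ((((endoGL (γ₂, u) : GL (Fin 3) K) : Matrix (Fin 3) (Fin 3) K) - (u : Matrix (Fin 1) (Fin 1) K) 0 0 • (1 : Matrix (Fin 3) (Fin 3) K)) *ᵥ ((ϖ ^ 1) • (x₀ - Pi.single 1 (x₀ 1))))) := by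
        rw [smul_smul, mul_inv_cancel₀ hϖD10, one_smul]
      rw [e3, LinearMap.map_smulₛₗ, LinearMap.smul_apply, smul_eq_mul, map_mul, hvσ, map_pow]
      exact (mul_le_mul' le_rfl (hAA _ hg _ hΓwA)).trans (le_of_eq (mul_one _))
    · -- `|σ(u−1)·⟨z, Γw⟩| ≤ |ϖ|^D·|ϖ|`
      rw [map_mul, hvσ, pow_succ (Valued.v ϖ) D]
      refine mul_le_mul' hδ ?_
      rw [hΓw, LinearMap.map_add]
      refine (Valuation.map_add _ _ _).trans (max_le ?_ ?_)
      · have := ((hWiff w).1 ⟨hw, hw1⟩).2.2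
        rwa [pow_one (Valued.v ϖ)] at this
      · have e4 : (((endoGL (γ₂, u) : GL (Fin 3) K) : Matrix (Fin 3) (Fin 3) K) - 1) *ᵥ w = (ϖ ^ D) • ((ϖ ^ D)⁻¹ • ((((endoGL (γ₂, u) : GL (Fin 3) K) : Matrix (Fin 3) (Fin 3) K) - 1) *ᵥ w)) := by rw [smul_smul, mul_inv_cancel₀ hϖD0, one_smul]
        rw [e4, LinearMap.map_smul, smul_eq_mul, map_mul, map_pow]
        refine (mul_le_mul' le_rfl (hAA _ hzA _ hYwA)).trans ?_
        rw [mul_one]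
        exact (pow_le_pow_right_of_le_one' hϖ1 (show 1 ≤ D by omega)).trans (le_of_eq (pow_one _))
  constructor
  · rintro ⟨-, -, hc, hd⟩; exact ⟨hgen_iff.1 hc, hval_iff.1 hd⟩
  · rintro ⟨hg, hv⟩; exact ⟨ha, hWofgen hg, hgen_iff.2 hg, hval_iff.2 hv⟩

/-! ## §2 THE TWO REGIMES: `u` strictly shallower (K4′) ∕ strictly deeper (K4″) than `γ₂` on the axis -/

/-- **(K4′) REGIME «u STRICTLY SHALLOWER»: no collar lattice reaches the top level.**  If the axis vertex has `W`-level `≥ D + 1` (`(Γ − 1)(A(M) ∩ W) ⊆ ϖ^{D+1}·A(M)`) while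
`|u₀₀ − 1| = |ϖ|^D` exactly, then `¬ LEV_M(ϖ^D)` for EVERY collar lattice `M` of that axis vertex: by (K4) one would need `(Γ − u₀₀)z ∈ ϖ^{D+1}A(M)`, hence `(u₀₀ − 1)z ∈
ϖ^{D+1}A(M)`, i.e. `ϖ⁻¹z ∈ A(M) ⊆ A(M)^#`, contradicting `|⟨z, z⟩| = 1` (★ (c3-ii)).  So in this regime the collar of a region vertex contributes NO region member and its
«0»-part is exactly the E-token. [cite: Kottwitz1986, §3] [cite: Rogawski1990, §4.9 p. 55] -/
theorem collar_not_levTop_of_unit_shallower [IsPrincipalIdealRing 𝒪[K]] (σ : K →+* K) (hσ : ∀ a, σ (σ a) = a) (hvσ : ∀ a, Valued.v (σ a) = Valued.v a)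
    {ϖ : K} (hϖ : Valued.v ϖ = WithZero.exp (-1 : ℤ))
    {H₂ : Matrix (Fin 2) (Fin 2) K} (hH₂ : IsUnit H₂.det) (hH₂σ : (H₂.map σ)ᵀ = H₂) {h : K} (hh : Valued.v h = 1) (hhσ : σ h = h)
    {M : Submodule 𝒪[K] (Fin 3 → K)} (hM : IsSelfDualLattice σ ϖ (!![H₂ 0 0, 0, H₂ 0 1; 0, h, 0; H₂ 1 0, 0, H₂ 1 1] : Matrix (Fin 3) (Fin 3) K) M)
    (hb : ∀ a : K, (Pi.single 1 a : Fin 3 → K) ∈ M ↔ Valued.v a ≤ Valued.v ϖ ^ 1)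
    {x₀ : Fin 3 → K} (hx₀ : x₀ ∈ M) (hx₀1 : Valued.v (x₀ 1) * Valued.v ϖ ^ 1 = 1)
    (γ₂ : GL (Fin 2) K) (u : GL (Fin 1) K) (hΓU : endoGL (γ₂, u) ∈ unitaryGroupOfForm σ (!![H₂ 0 0, 0, H₂ 0 1; 0, h, 0; H₂ 1 0, 0, H₂ 1 1] : Matrix (Fin 3) (Fin 3) K)) {D : ℕ} (hD : 2 ≤ D)
    (hAlev : ∀ a ∈ M ⊓ LinearMap.ker ((LinearMap.proj (1 : Fin 3) : (Fin 3 → K) →ₗ[K] K).restrictScalars 𝒪[K]) ⊔ scaleLattice (ϖ ^ 1) M ⊔ Submodule.span 𝒪[K] {(Pi.single 1 1 : Fin 3 → K)}, (((endoGL (γ₂, u) : GL (Fin 3) K) : Matrix (Fin 3) (Fin 3) K) - 1) *ᵥ a ∈ scaleLattice (ϖ ^ D) (M ⊓ LinearMap.ker ((LinearMap.proj (1 : Fin 3) : (Fin 3 → K) →ₗ[K] K).restrictScalars 𝒪[K]) ⊔ scaleLattice (ϖ ^ 1) M ⊔ Submodule.span 𝒪[K] {(Pi.single 1 1 : Fin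 3 → K)}))
    (hAlevW : ∀ a ∈ M ⊓ LinearMap.ker ((LinearMap.proj (1 : Fin 3) : (Fin 3 → K) →ₗ[K] K).restrictScalars 𝒪[K]) ⊔ scaleLattice (ϖ ^ 1) M ⊔ Submodule.span 𝒪[K] {(Pi.single 1 1 : Fin 3 → K)}, a 1 = 0 → (((endoGL (γ₂, u) : GL (Fin 3) K) : Matrix (Fin 3) (Fin 3) K) - 1) *ᵥ a ∈ scaleLattice (ϖ ^ (D + 1)) (M ⊓ LinearMap.ker ((LinearMap.proj (1 : Fin 3) : (Fin 3 → K) →ₗ[K] K).restrictScalars 𝒪[K]) ⊔ scaleLattice (ϖ ^ 1) M ⊔ Submodule.span 𝒪[K] {(Pi.single 1 1 : Fin 3 → K)}))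
    (hu : Valued.v ((u : Matrix (Fin 1) (Fin 1) K) 0 0 - 1) = Valued.v ϖ ^ D) :
    ¬ ∀ y ∈ M, (((endoGL (γ₂, u) : GL (Fin 3) K) : Matrix (Fin 3) (Fin 3) K) - 1) *ᵥ y ∈ scaleLattice (ϖ ^ D) M := by
  intro hlev
  obtain ⟨hg, -⟩ := (collar_levTop_iff_of_axisLevel σ hσ hvσ hϖ hH₂ hH₂σ hh hhσ hM hb hx₀ hx₀1 γ₂ u hΓU hD hAlev).1 hlev
  have hY11 := endoGL_sub_one_apply_one_one γ₂ u
  have hYu := endoGL_sub_one_sub_smul_one γ₂ u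
  have hϖ0' : Valued.v ϖ ≠ 0 := by rw [hϖ]; exact WithZero.exp_ne_zero
  have hϖ0 : ϖ ≠ 0 := fun h0 => by rw [h0, map_zero] at hϖ0'; exact hϖ0' rfl
  have hϖD0' : Valued.v ϖ ^ D ≠ 0 := pow_ne_zero _ hϖ0'
  have hϖD10 : ϖ ^ (D + 1) ≠ 0 := pow_ne_zero _ hϖ0
  have hb1 : 1 ≤ 1 := le_refl 1
  obtain ⟨-, -, hASD⟩ := isSelfDualLattice_axisVertex_of_tubeCoordinate σ hσ hvσ hϖ hH₂ hH₂σ hh hhσ hM hb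
  have hAint := le_dualLatt_of_isVertexLattice hvσ hASD
  obtain ⟨hzA, hzz, -, -⟩ := cone_anatomy_of_tubeCoordinate σ hvσ hϖ hH₂ hh hM hb1 hb hx₀ hx₀1
  have hz1 : (((ϖ ^ 1) • (x₀ - Pi.single 1 (x₀ 1))) : Fin 3 → K) 1 = 0 := by simp
  -- `(u − 1)•z ∈ ϖ^{D+1}·A(M)`
  have e2 : ((u : Matrix (Fin 1) (Fin 1) K) 0 0 - 1) • ((ϖ ^ 1) • (x₀ - Pi.single 1 (x₀ 1))) = (((endoGL (γ₂, u) : GL (Fin 3) K) : Matrix (Fin 3) (Fin 3) K) - 1) *ᵥ ((ϖ ^ 1) • (x₀ - Pi.single 1 (x₀ 1))) - (((endoGL (γ₂, u) : GL (Fin 3) K) : Matrix (Fin 3) (Fin 3) K) - (u : Matrix (Fin 1) (Fin 1) K) 0 0 • (1 : Matrix (Fin 3) (Fin 3) K)) *ᵥ ((ϖ ^ 1) • (x₀ - Pi.single 1 (x₀ 1))) := by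
    rw [← hYu, sub_smul_one_mulVec, hY11, sub_sub_cancel]
  have h1 : ((u : Matrix (Fin 1) (Fin 1) K) 0 0 - 1) • ((ϖ ^ 1) • (x₀ - Pi.single 1 (x₀ 1))) ∈ scaleLattice (ϖ ^ (D + 1)) (M ⊓ LinearMap.ker ((LinearMap.proj (1 : Fin 3) : (Fin 3 → K) →ₗ[K] K).restrictScalars 𝒪[K]) ⊔ scaleLattice (ϖ ^ 1) M ⊔ Submodule.span 𝒪[K] {(Pi.single 1 1 : Fin 3 → K)}) := by
    rw [e2]; exact Submodule.sub_mem _ (hAlevW _ hzA hz1) hg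
  rw [mem_scaleLattice_iff hϖD10, smul_smul] at h1
  -- the scalar `(ϖ^{D+1})⁻¹(u − 1)` has value `|ϖ|⁻¹`, so `ϖ⁻¹ z ∈ A(M)`
  have hc : Valued.v ((ϖ ^ (D + 1))⁻¹ * ((u : Matrix (Fin 1) (Fin 1) K) 0 0 - 1)) = (Valued.v ϖ)⁻¹ := by
    rw [map_mul, map_inv₀, map_pow, hu, pow_succ, mul_inv_rev, mul_assoc, inv_mul_cancel₀ hϖD0', mul_one]
  have hc0 : (ϖ ^ (D + 1))⁻¹ * ((u : Matrix (Fin 1) (Fin 1) K) 0 0 - 1) ≠ 0 := fun h0 => by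
    rw [h0, map_zero] at hc; exact (inv_ne_zero hϖ0') hc.symm
  have hz' : ϖ⁻¹ • ((ϖ ^ 1) • (x₀ - Pi.single 1 (x₀ 1))) ∈ M ⊓ LinearMap.ker ((LinearMap.proj (1 : Fin 3) : (Fin 3 → K) →ₗ[K] K).restrictScalars 𝒪[K]) ⊔ scaleLattice (ϖ ^ 1) M ⊔ Submodule.span 𝒪[K] {(Pi.single 1 1 : Fin 3 → K)} := by
    have e : ϖ⁻¹ • ((ϖ ^ 1) • (x₀ - Pi.single 1 (x₀ 1))) = (ϖ⁻¹ * ((ϖ ^ (D + 1))⁻¹ * ((u : Matrix (Fin 1) (Fin 1) K) 0 0 - 1))⁻¹) • (((ϖ ^ (D + 1))⁻¹ * ((u : Matrix (Fin 1) (Fin 1) K) 0 0 - 1)) • ((ϖ ^ 1) • (x₀ - Pi.single 1 (x₀ 1)))) := by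
      conv_rhs => rw [smul_smul, mul_assoc, inv_mul_cancel₀ hc0, mul_one]
    rw [e]
    exact smul_mem_of_v_le _ (by rw [map_mul, map_inv₀, map_inv₀, hc, inv_inv, inv_mul_cancel₀ hϖ0']) h1
  -- but `|⟨z, z⟩| = 1`
  have hpair := (mem_dualLatt σ _ _ _).1 (hAint hz') _ hz'
  obtain ⟨z, hzdef⟩ : ∃ z : Fin 3 → K, z = ((ϖ ^ 1) • (x₀ - Pi.single 1 (x₀ 1))) := ⟨_, rfl⟩
  have hzz' := hzz
  rw [← hzdef] at hzz' hpair
  simp only [map_smulₛₗ, LinearMap.smul_apply, smul_eq_mul, RingHom.id_apply, map_mul, hvσ, map_inv₀, hzz', mul_one] at hpair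
  have : (1 : ℤᵐ⁰) < (Valued.v ϖ)⁻¹ * (Valued.v ϖ)⁻¹ := by
    have h1' : 1 < (Valued.v ϖ)⁻¹ := one_lt_inv_iff₀.2 ⟨zero_lt_iff.2 hϖ0', by rw [hϖ, ← WithZero.exp_zero, WithZero.exp_lt_exp]; omega⟩
    exact one_lt_mul_of_lt_of_le h1' h1'.le
  exact absurd hpair (not_le.2 this)

/-- **(K4″) REGIME «u STRICTLY DEEPER»**: if `|u₀₀ − 1| ≤ |ϖ|^{D+1}` then `LEV_M(ϖ^D) ⟺ (Γ − 1)·z ∈ ϖ^{D+1}·A(M) ∧ |val| ≤ |ϖ|²` — the collar lattices of the axis vertex in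
the region are those glued along a residual line `z̄ ∈ ker(ϖ^{−D}(γ₂ − 1) mod ϖ)` with two vanishing value digits. [cite: Kottwitz1986, §3] [cite: Rogawski1990, §4.9 p. 55] -/
theorem collar_levTop_iff_of_unit_deeper [IsPrincipalIdealRing 𝒪[K]] (σ : K →+* K) (hσ : ∀ a, σ (σ a) = a) (hvσ : ∀ a, Valued.v (σ a) = Valued.v a)
    {ϖ : K} (hϖ : Valued.v ϖ = WithZero.exp (-1 : ℤ))
    {H₂ : Matrix (Fin 2) (Fin 2) K} (hH₂ : IsUnit H₂.det) (hH₂σ : (H₂.map σ)ᵀ = H₂) {h : K} (hh : Valued.v h = 1) (hhσ : σ h = h)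
    {M : Submodule 𝒪[K] (Fin 3 → K)} (hM : IsSelfDualLattice σ ϖ (!![H₂ 0 0, 0, H₂ 0 1; 0, h, 0; H₂ 1 0, 0, H₂ 1 1] : Matrix (Fin 3) (Fin 3) K) M)
    (hb : ∀ a : K, (Pi.single 1 a : Fin 3 → K) ∈ M ↔ Valued.v a ≤ Valued.v ϖ ^ 1)
    {x₀ : Fin 3 → K} (hx₀ : x₀ ∈ M) (hx₀1 : Valued.v (x₀ 1) * Valued.v ϖ ^ 1 = 1)
    (γ₂ : GL (Fin 2) K) (u : GL (Fin 1) K) (hΓU : endoGL (γ₂, u) ∈ unitaryGroupOfForm σ (!![H₂ 0 0, 0, H₂ 0 1; 0, h, 0; H₂ 1 0, 0, H₂ 1 1] : Matrix (Fin 3) (Fin 3) K)) {D : ℕ} (hD : 2 ≤ D)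
    (hAlev : ∀ a ∈ M ⊓ LinearMap.ker ((LinearMap.proj (1 : Fin 3) : (Fin 3 → K) →ₗ[K] K).restrictScalars 𝒪[K]) ⊔ scaleLattice (ϖ ^ 1) M ⊔ Submodule.span 𝒪[K] {(Pi.single 1 1 : Fin 3 → K)}, (((endoGL (γ₂, u) : GL (Fin 3) K) : Matrix (Fin 3) (Fin 3) K) - 1) *ᵥ a ∈ scaleLattice (ϖ ^ D) (M ⊓ LinearMap.ker ((LinearMap.proj (1 : Fin 3) : (Fin 3 → K) →ₗ[K] K).restrictScalars 𝒪[K]) ⊔ scaleLattice (ϖ ^ 1) M ⊔ Submodule.span 𝒪[K] {(Pi.single 1 1 : Fin 3 → K)}))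
    (hu : Valued.v ((u : Matrix (Fin 1) (Fin 1) K) 0 0 - 1) ≤ Valued.v ϖ ^ (D + 1)) :
    (∀ y ∈ M, (((endoGL (γ₂, u) : GL (Fin 3) K) : Matrix (Fin 3) (Fin 3) K) - 1) *ᵥ y ∈ scaleLattice (ϖ ^ D) M) ↔
      ((((endoGL (γ₂, u) : GL (Fin 3) K) : Matrix (Fin 3) (Fin 3) K) - 1) *ᵥ ((ϖ ^ 1) • (x₀ - Pi.single 1 (x₀ 1))) ∈ scaleLattice (ϖ ^ (D + 1)) (M ⊓ LinearMap.ker ((LinearMap.proj (1 : Fin 3) : (Fin 3 → K) →ₗ[K] K).restrictScalars 𝒪[K]) ⊔ scaleLattice (ϖ ^ 1) M ⊔ Submodule.span 𝒪[K] {(Pi.single 1 1 : Fin 3 → K)}) ∧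
        Valued.v ((ϖ ^ D)⁻¹ * pairing σ (!![H₂ 0 0, 0, H₂ 0 1; 0, h, 0; H₂ 1 0, 0, H₂ 1 1] : Matrix (Fin 3) (Fin 3) K) (ϖ • x₀) ((((endoGL (γ₂, u) : GL (Fin 3) K) : Matrix (Fin 3) (Fin 3) K) - 1) *ᵥ (ϖ • x₀))) ≤ Valued.v ϖ ^ 2) := by
  rw [collar_levTop_iff_of_axisLevel σ hσ hvσ hϖ hH₂ hH₂σ hh hhσ hM hb hx₀ hx₀1 γ₂ u hΓU hD hAlev]
  have hY11 := endoGL_sub_one_apply_one_one γ₂ u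
  have hYu := endoGL_sub_one_sub_smul_one γ₂ u
  have hϖ0' : Valued.v ϖ ≠ 0 := by rw [hϖ]; exact WithZero.exp_ne_zero
  have hϖ0 : ϖ ≠ 0 := fun h0 => by rw [h0, map_zero] at hϖ0'; exact hϖ0' rfl
  have hϖD10 : ϖ ^ (D + 1) ≠ 0 := pow_ne_zero _ hϖ0
  have hϖD10' : Valued.v ϖ ^ (D + 1) ≠ 0 := pow_ne_zero _ hϖ0'
  have hb1 : 1 ≤ 1 := le_refl 1
  obtain ⟨hzA, -, -, -⟩ := cone_anatomy_of_tubeCoordinate σ hvσ hϖ hH₂ hh hM hb1 hb hx₀ hx₀1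
  have e2 : (((endoGL (γ₂, u) : GL (Fin 3) K) : Matrix (Fin 3) (Fin 3) K) - (u : Matrix (Fin 1) (Fin 1) K) 0 0 • (1 : Matrix (Fin 3) (Fin 3) K)) *ᵥ ((ϖ ^ 1) • (x₀ - Pi.single 1 (x₀ 1))) = (((endoGL (γ₂, u) : GL (Fin 3) K) : Matrix (Fin 3) (Fin 3) K) - 1) *ᵥ ((ϖ ^ 1) • (x₀ - Pi.single 1 (x₀ 1))) - ((u : Matrix (Fin 1) (Fin 1) K) 0 0 - 1) • ((ϖ ^ 1) • (x₀ - Pi.single 1 (x₀ 1))) := by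
    rw [← hYu, sub_smul_one_mulVec, hY11]
  have hδz : ((u : Matrix (Fin 1) (Fin 1) K) 0 0 - 1) • ((ϖ ^ 1) • (x₀ - Pi.single 1 (x₀ 1))) ∈ scaleLattice (ϖ ^ (D + 1)) (M ⊓ LinearMap.ker ((LinearMap.proj (1 : Fin 3) : (Fin 3 → K) →ₗ[K] K).restrictScalars 𝒪[K]) ⊔ scaleLattice (ϖ ^ 1) M ⊔ Submodule.span 𝒪[K] {(Pi.single 1 1 : Fin 3 → K)}) := by
    rw [mem_scaleLattice_iff hϖD10, smul_smul]
    exact smul_mem_of_v_le _ (by rw [map_mul, map_inv₀, map_pow, inv_mul_le_iff₀ (zero_lt_iff.2 hϖD10'), mul_one]; exact hu) hzA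
  rw [e2, Submodule.sub_mem_iff_left _ hδz]

end Literature.NumberTheory.Automorphic.UnitaryLatticeTree

end
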